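/-
Copyright: the b2b-balaban T⁴-continuum CRUX team, row NE7b OWNER lineage `t4-ne7b-p1` (gen 142). Project licence.
-/
import Summits.QuantumFields.BalabanUV.T4Continuum.Spine.NE7b.SupWhitenedFourthKernelLetter
import Summits.QuantumFields.BalabanUV.T4Continuum.Spine.NE7b.SupFiniteRangeFourthCumulant
import Summits.QuantumFields.BalabanUV.T4Continuum.Spine.NE7b.SupHessianVectorGeometryLetters

/-!
# THE ORDER-FOUR KERNEL LETTER FOR A FINITE-RANGE FACTOR — THE WEIGHTS, THE NEUMANN `D` AND THE PROFILE LETTERS DISCHARGED (SCOPING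
# (d13)(2), twelfth file).  (523) bounds `Σ_{y,z,t}|∂⁴W(ψ)[e_y,e_z,e_t,e_x]|` for a general `Γ = AAᵀ` under abstract weights `θ, σ, ρ, r`, an
# admissible `D` with plain and weighted letters `dr, dc, dθ, dθ′` and profile letters `αθ, βθ`.  For placements `p : ι → X`, `q : κ → X`
# in one pseudometric space, a rate `μ ≥ 0`, a factor of RANGE `R` (`A_uw = 0 ∨ d(pu,qw) ≤ R`), a Hessian majorant of range `R′` and a third
# majorant of range `R₃` in its last slot, everything is discharged exactly as (476)∕(499)∕(510)∕(485) did at order three and for `κ₄`: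
# `θ = e^{8μd(q,q)}`, `σ = e^{8μd(p,q)}`, `ρ = e^{μd(p,p)}` (`ρ⁸ ≤ σσ`), `r = e^{(μ∕3)d(p,p)}` (`r²⁴ ≤ σσ`), `D` the Neumann series of the whitened
# Dobrushin matrix (`dr ≤ dθ = (1−γθ)⁻¹`, `dc ≤ dθ′ = (1−γθ′)⁻¹` since `θ ≥ 1`), `γθ = e^{8μ(2R+R′)}αc·hr·αr∕(1−lamA)`, `γθ′` likewise with
# `hc`, and ONE profile letter `αθ = βθ = e^{8μ(R+R′)}hr·αr + e^{8μ(R+R₃)}αr·k3e` serving both the gradient and the Hessian-vector profiles.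
# What remains hypothesis: the class letters, the plain factor letters, the weighted SMALLNESS `γθ, γθ′ < 1`, the site letters `S` (for `ρ`),
# `S′` (for `r`) and the support count `n` (row NE7b, node U5c; (523), (476), (499), (510), (485) BY NAME; [folklore])

Cell `pub-balaban`, sub-cell `t4`, spine estimate NE7b (`T4WeightBudget.RelWeightBound`; the cell's OWN estimate — NOT PRINTED in
[Bałaban 1983–89], NOT PROVED).  Crux-route work under `Spine/NE7b/` by the row OWNER (`t4-ne7b-p1` gen 142, file (524)) under FREEZE
(0)'s crux-prover clause; NOTHING of Bałaban's is named as a Lean object, valued or asserted; no `T4Continuum/Support` leaf typed; no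
`def`, no notation; zero `sorry`.  Imports (BY NAME): the OWNER's (523) `…SupWhitenedFourthKernelLetter` (`whitened_fourth_kernel_letter`), (499)
`…SupFiniteRangeFourthCumulant` (`r_pow_24_le`; (476) `…SupFiniteRangeGeometryLetters` and (485) `…SupWhitenedNeumannAdmissible` through it),
(510) `…SupHessianVectorGeometryLetters` (`weighted_hess_rowsum_le`, `weighted_hess_entry_le`).

WHAT IS PROVED ([folklore]): THE END **`finite_range_fourth_kernel_letter`**; §2 toy.

HONEST (what this is NOT).  An instantiation; the site letters `S, S′` and the support count `n` are properties of the lattice placement (NOT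
typed: `tsum` exercises), the weighted smallness is a condition on `μ·range` and the Dobrushin constant (NOT on `Γ`); the order-4 block of the
kernel-letter CLASS MAP and the `C⁴` repackaging are NOT typed; order five NOT typed.  Scalar skeleton ((A3), NC-NE7b-α UNRULED); nothing of
Bałaban's asserted.  BY-NAME EFFECT ON THE WALL: NONE.  NE7b NOT PRINTED ∕ NOT PROVED; spine PROVED 0∕9; rung (B)+1 — the programme's measures
remain FINITE-torus statements; NOT the mass gap, NOT Clay.  HONEST DEPENDENCY: continuum YM on T⁴ ⇐ BetaPertH ∧ nine spine estimates (0∕9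
proved); BetaPertH ⇐ (D1) ∧ (D4) ∧ CAP+tail; G-an2-4 gates asym, D1 and NE2∕3∕4.
-/

set_option autoImplicit false
set_option maxSynthPendingDepth 3

noncomputable section

namespace Summit.QuantumFields.BalabanUV.T4Continuum.NE7b.SupFiniteRangeFourthKernelLetter

open MeasureTheory ProbabilityTheory Real Set Function Finset Matrix
open scoped BigOperators
open SupWhitenedFourthKernelLetter (whitened_fourth_kernel_letter)
open SupFiniteRangeGeometryLetters (expw_one_le expw_diag expw_triangle rho_pow_eight_le sigma_theta weighted_cross_rowsum_le
  weighted_cross_colsum_le weighted_obs_rowsum_le weighted_obs_entry_le)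
open SupFiniteRangeFourthCumulant (r_pow_24_le)
open SupHessianVectorGeometryLetters (weighted_hess_rowsum_le weighted_hess_entry_le)
open SupWhitenedNeumannAdmissible (neumannD_nonneg neumannD_dominates neumannD_weighted_rowsum neumannD_weighted_colsum)

variable {ι κ X : Type} [Fintype ι] [DecidableEq ι] [Fintype κ] [DecidableEq κ] [PseudoMetricSpace X]

section TheEnd

variable {U : EuclideanSpace ℝ ι → ℝ} {U' : EuclideanSpace ℝ ι → EuclideanSpace ℝ ι →L[ℝ] ℝ}
  {U'' : EuclideanSpace ℝ ι → EuclideanSpace ℝ ι →L[ℝ] EuclideanSpace ℝ ι →L[ℝ] ℝ}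
  {U₃ : EuclideanSpace ℝ ι → EuclideanSpace ℝ ι →L[ℝ] EuclideanSpace ℝ ι →L[ℝ] EuclideanSpace ℝ ι →L[ℝ] ℝ}
  {U₄ : EuclideanSpace ℝ ι → EuclideanSpace ℝ ι →L[ℝ] EuclideanSpace ℝ ι →L[ℝ] EuclideanSpace ℝ ι →L[ℝ] EuclideanSpace ℝ ι →L[ℝ] ℝ}
  {Hk : ι → ι → ℝ} {K3 : ι → ι → ι → ℝ} {K4 : ι → ι → ι → ι → ℝ} {A : Matrix ι κ ℝ} {p : ι → X} {q : κ → X}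
  {γop κ₀ κ₁ κ₂ κ₃ κ₄ κ₄r a τ δ θp lam lamA αr αc hr hc k3r k3c k3e k4r k4c γ μ R R' R₃ S S' : ℝ} {n : ℕ}

/-- **THE END — THE ORDER-FOUR KERNEL LETTER FOR A FINITE-RANGE FACTOR**: (523) with every weight, the admissible `D` and the profile letters
instantiated from the finite-range geometry; the ONLY hypotheses beyond the class∕factor letters are `μ ≥ 0`, the ranges, the weighted
smallness `γθ, γθ′ < 1`, the site letters `S, S′` and the support count `n`. [folklore] -/
theorem finite_range_fourth_kernel_letter [Nonempty κ] (hΓop : (γop • (1 : Matrix ι ι ℝ) - A * Aᵀ).PosSemidef) (Y : Finset ι)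
    (hUd : ∀ φ : EuclideanSpace ℝ ι, HasFDerivAt U (U' φ) φ) (hU'd : ∀ φ : EuclideanSpace ℝ ι, HasFDerivAt U' (U'' φ) φ)
    (hU''d : ∀ φ : EuclideanSpace ℝ ι, HasFDerivAt U'' (U₃ φ) φ) (hU₃d : ∀ φ : EuclideanSpace ℝ ι, HasFDerivAt U₃ (U₄ φ) φ) (hU₄c : Continuous U₄)
    (hκ₀ : 0 ≤ κ₀) (hκ₁ : 0 ≤ κ₁) (ha : 0 ≤ a) (hτ : 0 < τ) (hδ : 0 < δ) (hθ0 : 0 < θp) (hθ1 : θp < 1)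
    (hκθ : (2 * κ₀ * (1 + τ) + 4 * δ) * γop ≤ θp) (hκθw : 2 * κ₀ * (1 + τ) * γop + 4 * δ ≤ θp)
    (hstab : ∀ φ : EuclideanSpace ℝ ι, -(κ₀ * ∑ x ∈ Y, φ x ^ 2) ≤ U φ)
    (hU'b : ∀ φ : EuclideanSpace ℝ ι, ‖U' φ‖ ≤ κ₁ * (a + ∑ x ∈ Y, φ x ^ 2)) (hU''b : ∀ φ : EuclideanSpace ℝ ι, ‖U'' φ‖ ≤ κ₂)
    (hU₃b : ∀ φ : EuclideanSpace ℝ ι, ‖U₃ φ‖ ≤ κ₃) (hU₄b : ∀ φ : EuclideanSpace ℝ ι, ‖U₄ φ‖ ≤ κ₄) (hlam : 0 ≤ lam)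
    (hUsec : ∀ s : ℝ, 0 ≤ s → s ≤ 1 → ∀ a b : EuclideanSpace ℝ ι,
      U ((1 - s) • a + s • b) - lam / 2 * (s * (1 - s)) * ∑ i, (a i - b i) ^ 2 ≤ (1 - s) * U a + s * U b)
    (hρg : lam * γop < 1)
    -- the majorants of orders two, three, four and their letters
    (hHk : ∀ (φ : EuclideanSpace ℝ ι) (x z : ι), |U'' φ (EuclideanSpace.single z (1 : ℝ)) (EuclideanSpace.single x (1 : ℝ))| ≤ Hk x z)
    (hHk0 : ∀ v u, 0 ≤ Hk v u)
    (hK3 : ∀ (φ : EuclideanSpace ℝ ι) (u x y : ι),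
      |U₃ φ (EuclideanSpace.single u (1 : ℝ)) (EuclideanSpace.single x (1 : ℝ)) (EuclideanSpace.single y (1 : ℝ))| ≤ K3 x y u)
    (hK30 : ∀ x y u, 0 ≤ K3 x y u)
    (hK4 : ∀ (φ : EuclideanSpace ℝ ι) (u x y z : ι), |U₄ φ (EuclideanSpace.single u (1 : ℝ)) (EuclideanSpace.single x (1 : ℝ))
      (EuclideanSpace.single y (1 : ℝ)) (EuclideanSpace.single z (1 : ℝ))| ≤ K4 x y z u)
    (hK40 : ∀ x y z u, 0 ≤ K4 x y z u)
    (hU₄row : ∀ (φ : EuclideanSpace ℝ ι) (x : ι), ∑ y, ∑ z, ∑ t, |U₄ φ (EuclideanSpace.single x (1 : ℝ)) (EuclideanSpace.single y (1 : ℝ))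
      (EuclideanSpace.single z (1 : ℝ)) (EuclideanSpace.single t (1 : ℝ))| ≤ κ₄r)
    (hhr : ∀ v, ∑ u, Hk v u ≤ hr) (hhc : ∀ u, ∑ v, Hk v u ≤ hc) (hk3r : ∀ x, ∑ y, ∑ u, K3 x y u ≤ k3r) (hk3c : ∀ u, ∑ y, ∑ z, K3 y z u ≤ k3c)
    (hk3e : ∀ x y, ∑ u, K3 x y u ≤ k3e) (hk4r : ∀ x, ∑ y, ∑ z, ∑ u, K4 x y z u ≤ k4r) (hk4c : ∀ u, ∑ y, ∑ z, ∑ t, K4 y z t u ≤ k4c)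
    -- the factor's letters and the smallness
    (ψ : EuclideanSpace ℝ ι) (hαr : ∀ u, ∑ w, |A u w| ≤ αr) (hαc : ∀ w, ∑ u, |A u w| ≤ αc)
    (hlamA : ∀ x : κ, ∑ u, ∑ v, |A u x| * |A v x| * Hk v u ≤ lamA) (hlamA1 : lamA < 1) (hγ : αc * hr * αr / (1 - lamA) ≤ γ) (hγ1 : γ < 1)
    -- the geometry: placements, rate, ranges, the weighted smallness, the site letters, the support count
    (hμ : 0 ≤ μ) (hAR : ∀ u w, A u w = 0 ∨ dist (p u) (q w) ≤ R) (hHkR : ∀ v u, Hk v u = 0 ∨ dist (p v) (p u) ≤ R')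
    (hK3R : ∀ x y u, K3 x y u = 0 ∨ dist (p x) (p u) ≤ R₃)
    (hγθ1 : Real.exp (8 * μ * (2 * R + R')) * (αc * hr * αr) / (1 - lamA) < 1) (hγθ'1 : Real.exp (8 * μ * (2 * R + R')) * (αc * hc * αr) / (1 - lamA)
        < 1)
    (x : ι) (hS : ∑ y, 1 / Real.exp (μ * dist (p x) (p y)) ≤ S) (hS' : ∀ u, ∑ v, (Real.exp (μ / 3 * dist (p u) (p v)) ^ 2)⁻¹ ≤ S')
    (hn : ∀ y : ι, (Finset.univ.filter (fun z => Hk z y ≠ 0)).card ≤ n) :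
    ∑ y, ∑ z, ∑ t, |(∫ ω : EuclideanSpace ℝ ι, exp (-U (ω + ψ)) ∂(multivariateGaussian 0 (A * Aᵀ)))⁻¹ * (∫ ω : EuclideanSpace ℝ ι, exp (-U (ω + ψ)) *
        U₄ (ω + ψ) (EuclideanSpace.single x (1 : ℝ)) (EuclideanSpace.single y (1 : ℝ)) (EuclideanSpace.single z (1 : ℝ)) (EuclideanSpace.single t (1
        : ℝ)) ∂(multivariateGaussian 0 (A * Aᵀ))) -
        (((∫ ω : EuclideanSpace ℝ ι, exp (-U (ω + ψ)) ∂(multivariateGaussian 0 (A * Aᵀ)))⁻¹ * (∫ ω : EuclideanSpace ℝ ι, exp (-U (ω + ψ)) * (U₃ (ω +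
            ψ) (EuclideanSpace.single x (1 : ℝ)) (EuclideanSpace.single z (1 : ℝ)) (EuclideanSpace.single t (1 : ℝ)) * U' (ω + ψ)
            (EuclideanSpace.single y (1 : ℝ))) ∂(multivariateGaussian 0 (A * Aᵀ))) - ((∫ ω : EuclideanSpace ℝ ι, exp (-U (ω + ψ))
            ∂(multivariateGaussian 0 (A * Aᵀ))) ^ 2)⁻¹ * ((∫ ω : EuclideanSpace ℝ ι, exp (-U (ω + ψ)) * U₃ (ω + ψ) (EuclideanSpace.single x (1 : ℝ))
            (EuclideanSpace.single z (1 : ℝ)) (EuclideanSpace.single t (1 : ℝ)) ∂(multivariateGaussian 0 (A * Aᵀ))) * (∫ ω : EuclideanSpace ℝ ι, exp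
            (-U (ω + ψ)) * U' (ω + ψ) (EuclideanSpace.single y (1 : ℝ)) ∂(multivariateGaussian 0 (A * Aᵀ))))) + ((∫ ω : EuclideanSpace ℝ ι, exp (-U
            (ω + ψ)) ∂(multivariateGaussian 0 (A * Aᵀ)))⁻¹ * (∫ ω : EuclideanSpace ℝ ι, exp (-U (ω + ψ)) * (U₃ (ω + ψ) (EuclideanSpace.single x (1 :
            ℝ)) (EuclideanSpace.single y (1 : ℝ)) (EuclideanSpace.single t (1 : ℝ)) * U' (ω + ψ) (EuclideanSpace.single z (1 : ℝ)))
            ∂(multivariateGaussian 0 (A * Aᵀ))) - ((∫ ω : EuclideanSpace ℝ ι, exp (-U (ω + ψ)) ∂(multivariateGaussian 0 (A * Aᵀ))) ^ 2)⁻¹ * ((∫ ω :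
            EuclideanSpace ℝ ι, exp (-U (ω + ψ)) * U₃ (ω + ψ) (EuclideanSpace.single x (1 : ℝ)) (EuclideanSpace.single y (1 : ℝ))
            (EuclideanSpace.single t (1 : ℝ)) ∂(multivariateGaussian 0 (A * Aᵀ))) * (∫ ω : EuclideanSpace ℝ ι, exp (-U (ω + ψ)) * U' (ω + ψ)
            (EuclideanSpace.single z (1 : ℝ)) ∂(multivariateGaussian 0 (A * Aᵀ))))) + ((∫ ω : EuclideanSpace ℝ ι, exp (-U (ω + ψ))
            ∂(multivariateGaussian 0 (A * Aᵀ)))⁻¹ * (∫ ω : EuclideanSpace ℝ ι, exp (-U (ω + ψ)) * (U₃ (ω + ψ) (EuclideanSpace.single x (1 : ℝ))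
            (EuclideanSpace.single y (1 : ℝ)) (EuclideanSpace.single z (1 : ℝ)) * U' (ω + ψ) (EuclideanSpace.single t (1 : ℝ)))
            ∂(multivariateGaussian 0 (A * Aᵀ))) - ((∫ ω : EuclideanSpace ℝ ι, exp (-U (ω + ψ)) ∂(multivariateGaussian 0 (A * Aᵀ))) ^ 2)⁻¹ * ((∫ ω :
            EuclideanSpace ℝ ι, exp (-U (ω + ψ)) * U₃ (ω + ψ) (EuclideanSpace.single x (1 : ℝ)) (EuclideanSpace.single y (1 : ℝ))
            (EuclideanSpace.single z (1 : ℝ)) ∂(multivariateGaussian 0 (A * Aᵀ))) * (∫ ω : EuclideanSpace ℝ ι, exp (-U (ω + ψ)) * U' (ω + ψ)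
            (EuclideanSpace.single t (1 : ℝ)) ∂(multivariateGaussian 0 (A * Aᵀ))))) + ((∫ ω : EuclideanSpace ℝ ι, exp (-U (ω + ψ))
            ∂(multivariateGaussian 0 (A * Aᵀ)))⁻¹ * (∫ ω : EuclideanSpace ℝ ι, exp (-U (ω + ψ)) * (U' (ω + ψ) (EuclideanSpace.single x (1 : ℝ)) * U₃
            (ω + ψ) (EuclideanSpace.single y (1 : ℝ)) (EuclideanSpace.single z (1 : ℝ)) (EuclideanSpace.single t (1 : ℝ))) ∂(multivariateGaussian 0
            (A * Aᵀ))) - ((∫ ω : EuclideanSpace ℝ ι, exp (-U (ω + ψ)) ∂(multivariateGaussian 0 (A * Aᵀ))) ^ 2)⁻¹ * ((∫ ω : EuclideanSpace ℝ ι, exp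
            (-U (ω + ψ)) * U' (ω + ψ) (EuclideanSpace.single x (1 : ℝ)) ∂(multivariateGaussian 0 (A * Aᵀ))) * (∫ ω : EuclideanSpace ℝ ι, exp (-U (ω +
            ψ)) * U₃ (ω + ψ) (EuclideanSpace.single y (1 : ℝ)) (EuclideanSpace.single z (1 : ℝ)) (EuclideanSpace.single t (1 : ℝ))
            ∂(multivariateGaussian 0 (A * Aᵀ)))))) -
        (((∫ ω : EuclideanSpace ℝ ι, exp (-U (ω + ψ)) ∂(multivariateGaussian 0 (A * Aᵀ)))⁻¹ * (∫ ω : EuclideanSpace ℝ ι, exp (-U (ω + ψ)) * (U'' (ω +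
            ψ) (EuclideanSpace.single x (1 : ℝ)) (EuclideanSpace.single y (1 : ℝ)) * U'' (ω + ψ) (EuclideanSpace.single z (1 : ℝ))
            (EuclideanSpace.single t (1 : ℝ))) ∂(multivariateGaussian 0 (A * Aᵀ))) - ((∫ ω : EuclideanSpace ℝ ι, exp (-U (ω + ψ))
            ∂(multivariateGaussian 0 (A * Aᵀ))) ^ 2)⁻¹ * ((∫ ω : EuclideanSpace ℝ ι, exp (-U (ω + ψ)) * U'' (ω + ψ) (EuclideanSpace.single x (1 : ℝ))
            (EuclideanSpace.single y (1 : ℝ)) ∂(multivariateGaussian 0 (A * Aᵀ))) * (∫ ω : EuclideanSpace ℝ ι, exp (-U (ω + ψ)) * U'' (ω + ψ)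
            (EuclideanSpace.single z (1 : ℝ)) (EuclideanSpace.single t (1 : ℝ)) ∂(multivariateGaussian 0 (A * Aᵀ))))) + ((∫ ω : EuclideanSpace ℝ ι,
            exp (-U (ω + ψ)) ∂(multivariateGaussian 0 (A * Aᵀ)))⁻¹ * (∫ ω : EuclideanSpace ℝ ι, exp (-U (ω + ψ)) * (U'' (ω + ψ)
            (EuclideanSpace.single x (1 : ℝ)) (EuclideanSpace.single z (1 : ℝ)) * U'' (ω + ψ) (EuclideanSpace.single y (1 : ℝ))
            (EuclideanSpace.single t (1 : ℝ))) ∂(multivariateGaussian 0 (A * Aᵀ))) - ((∫ ω : EuclideanSpace ℝ ι, exp (-U (ω + ψ))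
            ∂(multivariateGaussian 0 (A * Aᵀ))) ^ 2)⁻¹ * ((∫ ω : EuclideanSpace ℝ ι, exp (-U (ω + ψ)) * U'' (ω + ψ) (EuclideanSpace.single x (1 : ℝ))
            (EuclideanSpace.single z (1 : ℝ)) ∂(multivariateGaussian 0 (A * Aᵀ))) * (∫ ω : EuclideanSpace ℝ ι, exp (-U (ω + ψ)) * U'' (ω + ψ)
            (EuclideanSpace.single y (1 : ℝ)) (EuclideanSpace.single t (1 : ℝ)) ∂(multivariateGaussian 0 (A * Aᵀ))))) + ((∫ ω : EuclideanSpace ℝ ι,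
            exp (-U (ω + ψ)) ∂(multivariateGaussian 0 (A * Aᵀ)))⁻¹ * (∫ ω : EuclideanSpace ℝ ι, exp (-U (ω + ψ)) * (U'' (ω + ψ)
            (EuclideanSpace.single x (1 : ℝ)) (EuclideanSpace.single t (1 : ℝ)) * U'' (ω + ψ) (EuclideanSpace.single y (1 : ℝ))
            (EuclideanSpace.single z (1 : ℝ))) ∂(multivariateGaussian 0 (A * Aᵀ))) - ((∫ ω : EuclideanSpace ℝ ι, exp (-U (ω + ψ))
            ∂(multivariateGaussian 0 (A * Aᵀ))) ^ 2)⁻¹ * ((∫ ω : EuclideanSpace ℝ ι, exp (-U (ω + ψ)) * U'' (ω + ψ) (EuclideanSpace.single x (1 : ℝ))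
            (EuclideanSpace.single t (1 : ℝ)) ∂(multivariateGaussian 0 (A * Aᵀ))) * (∫ ω : EuclideanSpace ℝ ι, exp (-U (ω + ψ)) * U'' (ω + ψ)
            (EuclideanSpace.single y (1 : ℝ)) (EuclideanSpace.single z (1 : ℝ)) ∂(multivariateGaussian 0 (A * Aᵀ)))))) +
        ((∫ ω : EuclideanSpace ℝ ι, exp (-U (ω + ψ)) ∂(multivariateGaussian 0 (A * Aᵀ)))⁻¹ * (∫ ω : EuclideanSpace ℝ ι, exp (-U (ω + ψ)) * ((U'' (ω +
            ψ) (EuclideanSpace.single x (1 : ℝ)) (EuclideanSpace.single y (1 : ℝ)) - ((∫ ω : EuclideanSpace ℝ ι, exp (-U (ω + ψ))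
            ∂(multivariateGaussian 0 (A * Aᵀ)))⁻¹ * (∫ ω : EuclideanSpace ℝ ι, exp (-U (ω + ψ)) * U'' (ω + ψ) (EuclideanSpace.single x (1 : ℝ))
            (EuclideanSpace.single y (1 : ℝ)) ∂(multivariateGaussian 0 (A * Aᵀ))))) * (U' (ω + ψ) (EuclideanSpace.single z (1 : ℝ)) - ((∫ ω :
            EuclideanSpace ℝ ι, exp (-U (ω + ψ)) ∂(multivariateGaussian 0 (A * Aᵀ)))⁻¹ * (∫ ω : EuclideanSpace ℝ ι, exp (-U (ω + ψ)) * U' (ω + ψ)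
            (EuclideanSpace.single z (1 : ℝ)) ∂(multivariateGaussian 0 (A * Aᵀ))))) * (U' (ω + ψ) (EuclideanSpace.single t (1 : ℝ)) - ((∫ ω :
            EuclideanSpace ℝ ι, exp (-U (ω + ψ)) ∂(multivariateGaussian 0 (A * Aᵀ)))⁻¹ * (∫ ω : EuclideanSpace ℝ ι, exp (-U (ω + ψ)) * U' (ω + ψ)
            (EuclideanSpace.single t (1 : ℝ)) ∂(multivariateGaussian 0 (A * Aᵀ)))))) ∂(multivariateGaussian 0 (A * Aᵀ))) + (∫ ω : EuclideanSpace ℝ ι,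
            exp (-U (ω + ψ)) ∂(multivariateGaussian 0 (A * Aᵀ)))⁻¹ * (∫ ω : EuclideanSpace ℝ ι, exp (-U (ω + ψ)) * ((U'' (ω + ψ)
            (EuclideanSpace.single x (1 : ℝ)) (EuclideanSpace.single z (1 : ℝ)) - ((∫ ω : EuclideanSpace ℝ ι, exp (-U (ω + ψ)) ∂(multivariateGaussian
            0 (A * Aᵀ)))⁻¹ * (∫ ω : EuclideanSpace ℝ ι, exp (-U (ω + ψ)) * U'' (ω + ψ) (EuclideanSpace.single x (1 : ℝ)) (EuclideanSpace.single z (1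
            : ℝ)) ∂(multivariateGaussian 0 (A * Aᵀ))))) * (U' (ω + ψ) (EuclideanSpace.single y (1 : ℝ)) - ((∫ ω : EuclideanSpace ℝ ι, exp (-U (ω +
            ψ)) ∂(multivariateGaussian 0 (A * Aᵀ)))⁻¹ * (∫ ω : EuclideanSpace ℝ ι, exp (-U (ω + ψ)) * U' (ω + ψ) (EuclideanSpace.single y (1 : ℝ))
            ∂(multivariateGaussian 0 (A * Aᵀ))))) * (U' (ω + ψ) (EuclideanSpace.single t (1 : ℝ)) - ((∫ ω : EuclideanSpace ℝ ι, exp (-U (ω + ψ))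
            ∂(multivariateGaussian 0 (A * Aᵀ)))⁻¹ * (∫ ω : EuclideanSpace ℝ ι, exp (-U (ω + ψ)) * U' (ω + ψ) (EuclideanSpace.single t (1 : ℝ))
            ∂(multivariateGaussian 0 (A * Aᵀ)))))) ∂(multivariateGaussian 0 (A * Aᵀ))) + (∫ ω : EuclideanSpace ℝ ι, exp (-U (ω + ψ))
            ∂(multivariateGaussian 0 (A * Aᵀ)))⁻¹ * (∫ ω : EuclideanSpace ℝ ι, exp (-U (ω + ψ)) * ((U'' (ω + ψ) (EuclideanSpace.single x (1 : ℝ))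
            (EuclideanSpace.single t (1 : ℝ)) - ((∫ ω : EuclideanSpace ℝ ι, exp (-U (ω + ψ)) ∂(multivariateGaussian 0 (A * Aᵀ)))⁻¹ * (∫ ω :
            EuclideanSpace ℝ ι, exp (-U (ω + ψ)) * U'' (ω + ψ) (EuclideanSpace.single x (1 : ℝ)) (EuclideanSpace.single t (1 : ℝ))
            ∂(multivariateGaussian 0 (A * Aᵀ))))) * (U' (ω + ψ) (EuclideanSpace.single y (1 : ℝ)) - ((∫ ω : EuclideanSpace ℝ ι, exp (-U (ω + ψ))
            ∂(multivariateGaussian 0 (A * Aᵀ)))⁻¹ * (∫ ω : EuclideanSpace ℝ ι, exp (-U (ω + ψ)) * U' (ω + ψ) (EuclideanSpace.single y (1 : ℝ))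
            ∂(multivariateGaussian 0 (A * Aᵀ))))) * (U' (ω + ψ) (EuclideanSpace.single z (1 : ℝ)) - ((∫ ω : EuclideanSpace ℝ ι, exp (-U (ω + ψ))
            ∂(multivariateGaussian 0 (A * Aᵀ)))⁻¹ * (∫ ω : EuclideanSpace ℝ ι, exp (-U (ω + ψ)) * U' (ω + ψ) (EuclideanSpace.single z (1 : ℝ))
            ∂(multivariateGaussian 0 (A * Aᵀ)))))) ∂(multivariateGaussian 0 (A * Aᵀ))) + (∫ ω : EuclideanSpace ℝ ι, exp (-U (ω + ψ))
            ∂(multivariateGaussian 0 (A * Aᵀ)))⁻¹ * (∫ ω : EuclideanSpace ℝ ι, exp (-U (ω + ψ)) * ((U' (ω + ψ) (EuclideanSpace.single x (1 : ℝ)) -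
            ((∫ ω : EuclideanSpace ℝ ι, exp (-U (ω + ψ)) ∂(multivariateGaussian 0 (A * Aᵀ)))⁻¹ * (∫ ω : EuclideanSpace ℝ ι, exp (-U (ω + ψ)) * U' (ω
            + ψ) (EuclideanSpace.single x (1 : ℝ)) ∂(multivariateGaussian 0 (A * Aᵀ))))) * (U'' (ω + ψ) (EuclideanSpace.single y (1 : ℝ))
            (EuclideanSpace.single z (1 : ℝ)) - ((∫ ω : EuclideanSpace ℝ ι, exp (-U (ω + ψ)) ∂(multivariateGaussian 0 (A * Aᵀ)))⁻¹ * (∫ ω :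
            EuclideanSpace ℝ ι, exp (-U (ω + ψ)) * U'' (ω + ψ) (EuclideanSpace.single y (1 : ℝ)) (EuclideanSpace.single z (1 : ℝ))
            ∂(multivariateGaussian 0 (A * Aᵀ))))) * (U' (ω + ψ) (EuclideanSpace.single t (1 : ℝ)) - ((∫ ω : EuclideanSpace ℝ ι, exp (-U (ω + ψ))
            ∂(multivariateGaussian 0 (A * Aᵀ)))⁻¹ * (∫ ω : EuclideanSpace ℝ ι, exp (-U (ω + ψ)) * U' (ω + ψ) (EuclideanSpace.single t (1 : ℝ))
            ∂(multivariateGaussian 0 (A * Aᵀ)))))) ∂(multivariateGaussian 0 (A * Aᵀ))) + (∫ ω : EuclideanSpace ℝ ι, exp (-U (ω + ψ))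
            ∂(multivariateGaussian 0 (A * Aᵀ)))⁻¹ * (∫ ω : EuclideanSpace ℝ ι, exp (-U (ω + ψ)) * ((U' (ω + ψ) (EuclideanSpace.single x (1 : ℝ)) -
            ((∫ ω : EuclideanSpace ℝ ι, exp (-U (ω + ψ)) ∂(multivariateGaussian 0 (A * Aᵀ)))⁻¹ * (∫ ω : EuclideanSpace ℝ ι, exp (-U (ω + ψ)) * U' (ω
            + ψ) (EuclideanSpace.single x (1 : ℝ)) ∂(multivariateGaussian 0 (A * Aᵀ))))) * (U'' (ω + ψ) (EuclideanSpace.single y (1 : ℝ))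
            (EuclideanSpace.single t (1 : ℝ)) - ((∫ ω : EuclideanSpace ℝ ι, exp (-U (ω + ψ)) ∂(multivariateGaussian 0 (A * Aᵀ)))⁻¹ * (∫ ω :
            EuclideanSpace ℝ ι, exp (-U (ω + ψ)) * U'' (ω + ψ) (EuclideanSpace.single y (1 : ℝ)) (EuclideanSpace.single t (1 : ℝ))
            ∂(multivariateGaussian 0 (A * Aᵀ))))) * (U' (ω + ψ) (EuclideanSpace.single z (1 : ℝ)) - ((∫ ω : EuclideanSpace ℝ ι, exp (-U (ω + ψ))
            ∂(multivariateGaussian 0 (A * Aᵀ)))⁻¹ * (∫ ω : EuclideanSpace ℝ ι, exp (-U (ω + ψ)) * U' (ω + ψ) (EuclideanSpace.single z (1 : ℝ))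
            ∂(multivariateGaussian 0 (A * Aᵀ)))))) ∂(multivariateGaussian 0 (A * Aᵀ))) + (∫ ω : EuclideanSpace ℝ ι, exp (-U (ω + ψ))
            ∂(multivariateGaussian 0 (A * Aᵀ)))⁻¹ * (∫ ω : EuclideanSpace ℝ ι, exp (-U (ω + ψ)) * ((U' (ω + ψ) (EuclideanSpace.single x (1 : ℝ)) -
            ((∫ ω : EuclideanSpace ℝ ι, exp (-U (ω + ψ)) ∂(multivariateGaussian 0 (A * Aᵀ)))⁻¹ * (∫ ω : EuclideanSpace ℝ ι, exp (-U (ω + ψ)) * U' (ω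
            + ψ) (EuclideanSpace.single x (1 : ℝ)) ∂(multivariateGaussian 0 (A * Aᵀ))))) * (U'' (ω + ψ) (EuclideanSpace.single z (1 : ℝ))
            (EuclideanSpace.single t (1 : ℝ)) - ((∫ ω : EuclideanSpace ℝ ι, exp (-U (ω + ψ)) ∂(multivariateGaussian 0 (A * Aᵀ)))⁻¹ * (∫ ω :
            EuclideanSpace ℝ ι, exp (-U (ω + ψ)) * U'' (ω + ψ) (EuclideanSpace.single z (1 : ℝ)) (EuclideanSpace.single t (1 : ℝ))
            ∂(multivariateGaussian 0 (A * Aᵀ))))) * (U' (ω + ψ) (EuclideanSpace.single y (1 : ℝ)) - ((∫ ω : EuclideanSpace ℝ ι, exp (-U (ω + ψ))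
            ∂(multivariateGaussian 0 (A * Aᵀ)))⁻¹ * (∫ ω : EuclideanSpace ℝ ι, exp (-U (ω + ψ)) * U' (ω + ψ) (EuclideanSpace.single y (1 : ℝ))
            ∂(multivariateGaussian 0 (A * Aᵀ)))))) ∂(multivariateGaussian 0 (A * Aᵀ)))) -
        ((∫ ω : EuclideanSpace ℝ ι, exp (-U (ω + ψ)) ∂(multivariateGaussian 0 (A * Aᵀ)))⁻¹ * (∫ ω : EuclideanSpace ℝ ι, exp (-U (ω + ψ)) * ((U' (ω +
            ψ) (EuclideanSpace.single x (1 : ℝ)) - ((∫ ω : EuclideanSpace ℝ ι, exp (-U (ω + ψ)) ∂(multivariateGaussian 0 (A * Aᵀ)))⁻¹ * (∫ ω :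
            EuclideanSpace ℝ ι, exp (-U (ω + ψ)) * U' (ω + ψ) (EuclideanSpace.single x (1 : ℝ)) ∂(multivariateGaussian 0 (A * Aᵀ))))) * (U' (ω + ψ)
            (EuclideanSpace.single y (1 : ℝ)) - ((∫ ω : EuclideanSpace ℝ ι, exp (-U (ω + ψ)) ∂(multivariateGaussian 0 (A * Aᵀ)))⁻¹ * (∫ ω :
            EuclideanSpace ℝ ι, exp (-U (ω + ψ)) * U' (ω + ψ) (EuclideanSpace.single y (1 : ℝ)) ∂(multivariateGaussian 0 (A * Aᵀ))))) * (U' (ω + ψ)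
            (EuclideanSpace.single z (1 : ℝ)) - ((∫ ω : EuclideanSpace ℝ ι, exp (-U (ω + ψ)) ∂(multivariateGaussian 0 (A * Aᵀ)))⁻¹ * (∫ ω :
            EuclideanSpace ℝ ι, exp (-U (ω + ψ)) * U' (ω + ψ) (EuclideanSpace.single z (1 : ℝ)) ∂(multivariateGaussian 0 (A * Aᵀ))))) * (U' (ω + ψ)
            (EuclideanSpace.single t (1 : ℝ)) - ((∫ ω : EuclideanSpace ℝ ι, exp (-U (ω + ψ)) ∂(multivariateGaussian 0 (A * Aᵀ)))⁻¹ * (∫ ω :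
            EuclideanSpace ℝ ι, exp (-U (ω + ψ)) * U' (ω + ψ) (EuclideanSpace.single t (1 : ℝ)) ∂(multivariateGaussian 0 (A * Aᵀ))))))
            ∂(multivariateGaussian 0 (A * Aᵀ))) - ((∫ ω : EuclideanSpace ℝ ι, exp (-U (ω + ψ)) ∂(multivariateGaussian 0 (A * Aᵀ)))⁻¹ * (∫ ω :
            EuclideanSpace ℝ ι, exp (-U (ω + ψ)) * ((U' (ω + ψ) (EuclideanSpace.single x (1 : ℝ)) - ((∫ ω : EuclideanSpace ℝ ι, exp (-U (ω + ψ))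
            ∂(multivariateGaussian 0 (A * Aᵀ)))⁻¹ * (∫ ω : EuclideanSpace ℝ ι, exp (-U (ω + ψ)) * U' (ω + ψ) (EuclideanSpace.single x (1 : ℝ))
            ∂(multivariateGaussian 0 (A * Aᵀ))))) * (U' (ω + ψ) (EuclideanSpace.single y (1 : ℝ)) - ((∫ ω : EuclideanSpace ℝ ι, exp (-U (ω + ψ))
            ∂(multivariateGaussian 0 (A * Aᵀ)))⁻¹ * (∫ ω : EuclideanSpace ℝ ι, exp (-U (ω + ψ)) * U' (ω + ψ) (EuclideanSpace.single y (1 : ℝ))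
            ∂(multivariateGaussian 0 (A * Aᵀ)))))) ∂(multivariateGaussian 0 (A * Aᵀ)))) * ((∫ ω : EuclideanSpace ℝ ι, exp (-U (ω + ψ))
            ∂(multivariateGaussian 0 (A * Aᵀ)))⁻¹ * (∫ ω : EuclideanSpace ℝ ι, exp (-U (ω + ψ)) * ((U' (ω + ψ) (EuclideanSpace.single z (1 : ℝ)) -
            ((∫ ω : EuclideanSpace ℝ ι, exp (-U (ω + ψ)) ∂(multivariateGaussian 0 (A * Aᵀ)))⁻¹ * (∫ ω : EuclideanSpace ℝ ι, exp (-U (ω + ψ)) * U' (ω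
            + ψ) (EuclideanSpace.single z (1 : ℝ)) ∂(multivariateGaussian 0 (A * Aᵀ))))) * (U' (ω + ψ) (EuclideanSpace.single t (1 : ℝ)) - ((∫ ω :
            EuclideanSpace ℝ ι, exp (-U (ω + ψ)) ∂(multivariateGaussian 0 (A * Aᵀ)))⁻¹ * (∫ ω : EuclideanSpace ℝ ι, exp (-U (ω + ψ)) * U' (ω + ψ)
            (EuclideanSpace.single t (1 : ℝ)) ∂(multivariateGaussian 0 (A * Aᵀ)))))) ∂(multivariateGaussian 0 (A * Aᵀ)))) - ((∫ ω : EuclideanSpace ℝ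
            ι, exp (-U (ω + ψ)) ∂(multivariateGaussian 0 (A * Aᵀ)))⁻¹ * (∫ ω : EuclideanSpace ℝ ι, exp (-U (ω + ψ)) * ((U' (ω + ψ)
            (EuclideanSpace.single x (1 : ℝ)) - ((∫ ω : EuclideanSpace ℝ ι, exp (-U (ω + ψ)) ∂(multivariateGaussian 0 (A * Aᵀ)))⁻¹ * (∫ ω :
            EuclideanSpace ℝ ι, exp (-U (ω + ψ)) * U' (ω + ψ) (EuclideanSpace.single x (1 : ℝ)) ∂(multivariateGaussian 0 (A * Aᵀ))))) * (U' (ω + ψ)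
            (EuclideanSpace.single z (1 : ℝ)) - ((∫ ω : EuclideanSpace ℝ ι, exp (-U (ω + ψ)) ∂(multivariateGaussian 0 (A * Aᵀ)))⁻¹ * (∫ ω :
            EuclideanSpace ℝ ι, exp (-U (ω + ψ)) * U' (ω + ψ) (EuclideanSpace.single z (1 : ℝ)) ∂(multivariateGaussian 0 (A * Aᵀ))))))
            ∂(multivariateGaussian 0 (A * Aᵀ)))) * ((∫ ω : EuclideanSpace ℝ ι, exp (-U (ω + ψ)) ∂(multivariateGaussian 0 (A * Aᵀ)))⁻¹ * (∫ ω :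
            EuclideanSpace ℝ ι, exp (-U (ω + ψ)) * ((U' (ω + ψ) (EuclideanSpace.single y (1 : ℝ)) - ((∫ ω : EuclideanSpace ℝ ι, exp (-U (ω + ψ))
            ∂(multivariateGaussian 0 (A * Aᵀ)))⁻¹ * (∫ ω : EuclideanSpace ℝ ι, exp (-U (ω + ψ)) * U' (ω + ψ) (EuclideanSpace.single y (1 : ℝ))
            ∂(multivariateGaussian 0 (A * Aᵀ))))) * (U' (ω + ψ) (EuclideanSpace.single t (1 : ℝ)) - ((∫ ω : EuclideanSpace ℝ ι, exp (-U (ω + ψ))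
            ∂(multivariateGaussian 0 (A * Aᵀ)))⁻¹ * (∫ ω : EuclideanSpace ℝ ι, exp (-U (ω + ψ)) * U' (ω + ψ) (EuclideanSpace.single t (1 : ℝ))
            ∂(multivariateGaussian 0 (A * Aᵀ)))))) ∂(multivariateGaussian 0 (A * Aᵀ)))) - ((∫ ω : EuclideanSpace ℝ ι, exp (-U (ω + ψ))
            ∂(multivariateGaussian 0 (A * Aᵀ)))⁻¹ * (∫ ω : EuclideanSpace ℝ ι, exp (-U (ω + ψ)) * ((U' (ω + ψ) (EuclideanSpace.single x (1 : ℝ)) -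
            ((∫ ω : EuclideanSpace ℝ ι, exp (-U (ω + ψ)) ∂(multivariateGaussian 0 (A * Aᵀ)))⁻¹ * (∫ ω : EuclideanSpace ℝ ι, exp (-U (ω + ψ)) * U' (ω
            + ψ) (EuclideanSpace.single x (1 : ℝ)) ∂(multivariateGaussian 0 (A * Aᵀ))))) * (U' (ω + ψ) (EuclideanSpace.single t (1 : ℝ)) - ((∫ ω :
            EuclideanSpace ℝ ι, exp (-U (ω + ψ)) ∂(multivariateGaussian 0 (A * Aᵀ)))⁻¹ * (∫ ω : EuclideanSpace ℝ ι, exp (-U (ω + ψ)) * U' (ω + ψ)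
            (EuclideanSpace.single t (1 : ℝ)) ∂(multivariateGaussian 0 (A * Aᵀ)))))) ∂(multivariateGaussian 0 (A * Aᵀ)))) * ((∫ ω : EuclideanSpace ℝ
            ι, exp (-U (ω + ψ)) ∂(multivariateGaussian 0 (A * Aᵀ)))⁻¹ * (∫ ω : EuclideanSpace ℝ ι, exp (-U (ω + ψ)) * ((U' (ω + ψ)
            (EuclideanSpace.single y (1 : ℝ)) - ((∫ ω : EuclideanSpace ℝ ι, exp (-U (ω + ψ)) ∂(multivariateGaussian 0 (A * Aᵀ)))⁻¹ * (∫ ω :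
            EuclideanSpace ℝ ι, exp (-U (ω + ψ)) * U' (ω + ψ) (EuclideanSpace.single y (1 : ℝ)) ∂(multivariateGaussian 0 (A * Aᵀ))))) * (U' (ω + ψ)
            (EuclideanSpace.single z (1 : ℝ)) - ((∫ ω : EuclideanSpace ℝ ι, exp (-U (ω + ψ)) ∂(multivariateGaussian 0 (A * Aᵀ)))⁻¹ * (∫ ω :
            EuclideanSpace ℝ ι, exp (-U (ω + ψ)) * U' (ω + ψ) (EuclideanSpace.single z (1 : ℝ)) ∂(multivariateGaussian 0 (A * Aᵀ))))))
            ∂(multivariateGaussian 0 (A * Aᵀ)))))| ≤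
      κ₄r + (3 * (αr * k4r * (αc * hc)) + hr * αr * (αc * k4c) + 3 * (αr * k3r * (αc * k3c))) * (1 - (Real.exp (8 * μ * (2 * R + R')) * (αc * hr *
          αr) / (1 - lamA)))⁻¹ * (1 - (Real.exp (8 * μ * (2 * R + R')) * (αc * hc * αr) / (1 - lamA)))⁻¹ / (1 - lamA) +
        6 * (n * (4 * Real.sqrt ((5 * ((κ₂ ^ 4 + κ₃ ^ 4) * γop ^ 2) / (1 - lam * γop) ^ 2) * ((Real.exp (8 * μ * (R + R')) * (hr * αr) + Real.exp (8
            * μ * (R + R₃)) * (αr * k3e)) * (1 - (Real.exp (8 * μ * (2 * R + R')) * (αc * hr * αr) / (1 - lamA)))⁻¹ * ((Real.exp (8 * μ * (R + R')) *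
            (hr * αr) + Real.exp (8 * μ * (R + R₃)) * (αr * k3e)) * (1 - (Real.exp (8 * μ * (2 * R + R')) * (αc * hc * αr) / (1 - lamA)))⁻¹) / (1 -
            lamA))) * S ^ 2)) +
        (4 * ((Real.exp (8 * μ * (R + R')) * (hr * αr) + Real.exp (8 * μ * (R + R₃)) * (αr * k3e)) * (1 - (Real.exp (8 * μ * (2 * R + R')) * (αc * hr
            * αr) / (1 - lamA)))⁻¹ * ((Real.exp (8 * μ * (R + R')) * (hr * αr) + Real.exp (8 * μ * (R + R₃)) * (αr * k3e)) * (1 - (Real.exp (8 * μ *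
            (2 * R + R')) * (αc * hc * αr) / (1 - lamA)))⁻¹) / (1 - lamA)) + 3 * ((Real.exp (8 * μ * (R + R')) * (hr * αr) + Real.exp (8 * μ * (R +
            R₃)) * (αr * k3e)) * (1 - (Real.exp (8 * μ * (2 * R + R')) * (αc * hr * αr) / (1 - lamA)))⁻¹ * ((Real.exp (8 * μ * (R + R')) * (hr * αr)
            + Real.exp (8 * μ * (R + R₃)) * (αr * k3e)) * (1 - (Real.exp (8 * μ * (2 * R + R')) * (αc * hc * αr) / (1 - lamA)))⁻¹) / (1 - lamA)) ^ 2
            + 4 * (5 * (κ₂ ^ 4 * γop ^ 2) / (1 - lam * γop) ^ 2) + 4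
          * (50 * (κ₂ ^ 6 * γop ^ 3) / (1 - lam * γop) ^ 3) + 2 * (((5 * (κ₂ ^ 4 * γop ^ 2) / (1 - lam * γop) ^ 2) + 1) / 2) * ((((5 * (κ₂ ^ 4 * γop
              ^ 2) / (1 - lam * γop) ^ 2) + 1) / 2) + (5 *
          (κ₂ ^ 4 * γop ^ 2) / (1 - lam * γop) ^ 2))) * (16 * S' ^ 3) := by
  haveI : Nonempty ι := ⟨x⟩
  have hl1 : 0 < 1 - lamA := by linarith
  have hαr0 : 0 ≤ αr := (Finset.sum_nonneg fun w _ => abs_nonneg (A x w)).trans (hαr x)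
  have hhr0 : 0 ≤ hr := (Finset.sum_nonneg fun u _ => hHk0 x u).trans (hhr x)
  have hk3e0 : 0 ≤ k3e := (Finset.sum_nonneg fun u _ => hK30 x x u).trans (hk3e x x)
  have hA1 : 0 ≤ Real.exp (8 * μ * (R + R')) * (hr * αr) := mul_nonneg (Real.exp_pos _).le (mul_nonneg hhr0 hαr0)
  have hA2 : 0 ≤ Real.exp (8 * μ * (R + R₃)) * (αr * k3e) := mul_nonneg (Real.exp_pos _).le (mul_nonneg hαr0 hk3e0)
  have hβ : 0 ≤ (Real.exp (8 * μ * (R + R')) * (hr * αr) + Real.exp (8 * μ * (R + R₃)) * (αr * k3e)) := add_nonneg hA1 hA2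
  -- the weights `θ`: `≥ 1`, diagonal `1`, submultiplicative ((476))
  have hθw1 : ∀ z w : κ, 1 ≤ (fun z w : κ => Real.exp (8 * μ * dist (q z) (q w))) z w := fun z w => expw_one_le (by linarith) (q z) (q w)
  have hθdiag : ∀ z : κ, (fun z w : κ => Real.exp (8 * μ * dist (q z) (q w))) z z = 1 := fun z => by simp
  have hθmul : ∀ z y w : κ, (fun z w : κ => Real.exp (8 * μ * dist (q z) (q w))) z w ≤ (fun z w : κ => Real.exp (8 * μ * dist (q z) (q w))) z y *
      (fun z w : κ => Real.exp (8 * μ * dist (q z) (q w))) y w := fun z y w => expw_triangle (by linarith) (q z) (q y) (q w)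
  -- the Neumann `D` and its letters ((485)); plain sums from weighted sums since `θ ≥ 1`
  have hCθ := fun z => weighted_cross_rowsum_le hHk0 hαr hαc hhr hμ hAR hHkR hlamA1 z
  have hCθc := fun w => weighted_cross_colsum_le hHk0 hαr hαc hhc hμ hAR hHkR hlamA1 w
  have hD := neumannD_nonneg (A := A) hHk0 hlamA1
  have hDC := neumannD_dominates (A := A) hHk0 hlamA1 hθw1 hCθ hγθ1
  have hDθr := neumannD_weighted_rowsum (A := A) hHk0 hlamA1 hθw1 hθdiag hθmul hCθ hγθ1
  have hDθc := neumannD_weighted_colsum (A := A) hHk0 hlamA1 hθw1 hθdiag hθmul hCθc hγθ'1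
  have hDr : ∀ z, ∑ w, (fun x y : κ => ∑' n : ℕ, ((Matrix.of fun x w : κ => (if w = x then 0 else ∑ u, ∑ v, |A u w| * |A v x| * Hk v u) / (1 - lamA))
      ^ n) x y) z w ≤ (1 - (Real.exp (8 * μ * (2 * R + R')) * (αc * hr * αr) / (1 - lamA)))⁻¹ := fun z =>
    (Finset.sum_le_sum fun w _ => le_mul_of_one_le_right (hD z w) (hθw1 z w)).trans (hDθr z)
  have hDc : ∀ w, ∑ z, (fun x y : κ => ∑' n : ℕ, ((Matrix.of fun x w : κ => (if w = x then 0 else ∑ u, ∑ v, |A u w| * |A v x| * Hk v u) / (1 - lamA))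
      ^ n) x y) z w ≤ (1 - (Real.exp (8 * μ * (2 * R + R')) * (αc * hc * αr) / (1 - lamA)))⁻¹ := fun w =>
    (Finset.sum_le_sum fun z _ => le_mul_of_one_le_right (hD z w) (hθw1 z w)).trans (hDθc w)
  have hdθ : 0 ≤ (1 - (Real.exp (8 * μ * (2 * R + R')) * (αc * hr * αr) / (1 - lamA)))⁻¹ := inv_nonneg.2 (by linarith)
  have hdθ' : 0 ≤ (1 - (Real.exp (8 * μ * (2 * R + R')) * (αc * hc * αr) / (1 - lamA)))⁻¹ := inv_nonneg.2 (by linarith)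
  -- the `r`-site letter in the other direction (symmetry of `dist`)
  have hSc : ∀ v, ∑ u, ((fun x y : ι => Real.exp (μ / 3 * dist (p x) (p y))) u v ^ 2)⁻¹ ≤ S' := fun v => by
    have h := hS' v
    simp_rw [dist_comm (p v)] at h
    exact h
  exact whitened_fourth_kernel_letter (θ := (fun z w : κ => Real.exp (8 * μ * dist (q z) (q w)))) (σ := (fun x w => Real.exp (8 * μ * dist (p x) (q
      w)))) (ρ := (fun x y : ι => Real.exp (μ * dist (p x) (p y)))) (r := (fun x y : ι => Real.exp (μ / 3 * dist (p x) (p y)))) (D := (fun x y : κ =>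
      ∑' n : ℕ, ((Matrix.of fun x w : κ => (if w = x then 0 else ∑ u, ∑ v, |A u w| * |A v x| * Hk v u) / (1 - lamA)) ^ n) x y))
    hΓop Y hUd hU'd hU''d hU₃d hU₄c hκ₀ hκ₁ ha hτ hδ hθ0 hθ1 hκθ hκθw hstab hU'b hU''b hU₃b hU₄b hlam hUsec hρg hHk hHk0 hK3 hK30 hK4 hK40 hU₄row hhr
    hhc hk3r hk3c hk4r hk4c ψ hαr hαc hlamA hlamA1 hγ hγ1 hD hDC hDr hDc (fun z w => (Real.exp_pos _).le) hDθr hdθ hDθc hdθ'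
    (fun x w => (Real.exp_pos _).le) (fun x z w => sigma_theta hμ p q x z w)
    (fun x y => expw_one_le hμ (p x) (p y)) (fun x y => by rw [dist_comm]) (fun x y z => expw_triangle hμ (p x) (p y) (p z))
    (fun x y w => rho_pow_eight_le hμ p q x y w)
    (fun x y => expw_one_le (by linarith) (p x) (p y)) (fun x y w => r_pow_24_le hμ p q x y w)
    (fun v => (weighted_obs_rowsum_le hHk0 hαr hhr hμ hAR hHkR v).trans (le_add_of_nonneg_right hA2)) hβ
    (fun v w => (weighted_obs_entry_le hHk0 hαr hhr hμ hAR hHkR v w).trans (le_add_of_nonneg_right hA2))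
    (fun x y => (weighted_hess_rowsum_le hK30 hαr hk3e hμ hAR hK3R x y).trans (le_add_of_nonneg_left hA1))
    (fun x y w => (weighted_hess_entry_le hK30 hαr hk3e hμ hAR hK3R x y w).trans (le_add_of_nonneg_left hA1)) x hS hS' hSc hn

end TheEnd

/-! ## §2. Toy -/

/-- Toy (§1's plain-from-weighted step in numbers): `d ≤ d·θ` for `d ≥ 0`, `θ ≥ 1`. -/
example (d θ : ℝ) (hd : 0 ≤ d) (hθ : 1 ≤ θ) : d ≤ d * θ := le_mul_of_one_le_right hd hθ

end Summit.QuantumFields.BalabanUV.T4Continuum.NE7b.SupFiniteRangeFourthKernelLetter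

end
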